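import Summits.BirchSwinnertonDyer.BirchSwinnertonDyer.Theorems.PrintX11aUpperNonSurjFiveExcToolkitRoots
import Summits.BirchSwinnertonDyer.BirchSwinnertonDyer.Theorems.KimAtThreeDeepLowerOffStratumLevelLoweringMultiStabPeriodAnyLevel
import HarnessLib

/-!
# Crux U5 `PrintX11a.UpperNonSurjFive` (item stmt-BirchSwinnertonDyer-20614), line «gl1cartan5», EXCEPTIONAL-ZERO road:
# the CANONICAL-PERIOD NORMALISATION of `Ψ = plusSymbol (Σ cᵢ φᵢ)` at ANY level — integral on `ℚ`, a unit on one cycle —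
# over `ℚ̄_p` for a GENERAL prime `p`

Cell `bsd-print-x11a`, seat `cruxlead-stmt-BirchSwinnertonDyer-20614` (LEAD g6); `--supports stmt-BirchSwinnertonDyer-20614`,
closes nothing. File 4 of the EXCEPTIONAL-ZERO road: the bsd-addord acc2 theorems
`KimAtThreeDeepLowerOffStratumLevelLoweringMultiStabPeriod.{norm_psi_le_sup, exists_norm_psi_eq_sup}` (bounded denominators of the
plus symbol of `G = Σ cᵢ φᵢ` through Manin's chain; the maximum is attained on a path) and
`…MultiStabPeriodAnyLevel.exists_period_integral_unit_cycle_sum_smul_of_one_mod` (the normalisation `Ω`: `Ψ/Ω` integral on `ℚ` and a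
UNIT on one cycle `{∞, γ₀∞}`, from ONE prime `r ≡ 1 (mod N)` at which `T_r G = a G` with `a − r − 1` a unit — the reduced symbol is
constant on `Γ₀(N)`-cusp classes and the Hecke relation at `r` kills it) RE-PROVED over `PadicAlgCl p` for an arbitrary prime `p`;
proofs copied letter for letter; the `p`-free lemmas (`plusSymbol_sum_smul_eq`, `exists_psi_eq_sum`, `plusSymbol_sum_smul_eq_re`,
`exists_plusSymbol_sum_smul_eq_sub_of_cuspOrbitOf_eq`, `cuspOrbitOf_numDen_div_prime_eq`, `cuspOrbitOf_numDen_prime_mul_eq`,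
`smul_plusSymbol_of_heckeT`) are imported. On the exceptional-zero road `G` is the multi-stabilised level-lowered eigenform at level `N/p`
and `Ω` is (up to a unit) Vatsal's canonical period of `G`. Theorems only; no definition, no named fact, no `sorry`; BSD is not proved by this.

## References

* V. Vatsal, Duke Math. J. 98 (1999), §1 (1.3) display (5), (1.5)–(1.6), Remark (1.12) [Vatsal1999]; J. E. Cremona, *Algorithms for
  modular elliptic curves* (1997), §2.1–§2.4, §2.8 [CremonaAlgorithms1997]; F. Diamond, J. Shurman (2005), §3.8, Prop. 3.8.3
  [DiamondShurman2005]; B. Mazur, J. Tate, J. Teitelbaum, Invent. Math. 84 (1986), §I.8 [MazurTateTeitelbaum1986Invent].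
-/

set_option autoImplicit false
-- the Theorems namespace of a single-conjunct summit repeats the summit name by design (D-0017)
set_option linter.dupNamespace false

noncomputable section

open scoped MatrixGroups ModularForm Classical NNReal

open CongruenceSubgroup WeierstrassCurve Literature.NumberTheory.EllipticCurves
  Literature.NumberTheory.EllipticCurves.ModularForms ModularGroup
open UpperHalfPlane hiding I

namespace Summit.BirchSwinnertonDyer.BirchSwinnertonDyer.Theorems.GL1Cartan.Exc

open Literature.NumberTheory.EllipticCurves.ModularForms.DeligneSerreLift (norm_intCast_le_one)
open Summit.BirchSwinnertonDyer.BirchSwinnertonDyer.Theorems.KimAtThreeDeepLowerOffStratumLevelLoweringStabEigenform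
  (smul_plusSymbol_of_heckeT)
open Summit.BirchSwinnertonDyer.BirchSwinnertonDyer.Theorems.KimAtThreeDeepLowerOffStratumLevelLoweringCanonicalPeriod
  (exists_sl_apply_eq_num_den)
open Summit.BirchSwinnertonDyer.BirchSwinnertonDyer.Theorems.KimAtThreeDeepLowerOffStratumLevelLoweringMultiStabPeriod
  (plusSymbol_sum_smul plusSymbol_sum_smul_eq exists_psi_eq_sum plusSymbol_sum_smul_eq_re)
open Summit.BirchSwinnertonDyer.BirchSwinnertonDyer.Theorems.KimAtThreeDeepLowerOffStratumLevelLoweringMultiStabPeriodAnyLevel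
  (exists_plusSymbol_sum_smul_eq_sub_of_cuspOrbitOf_eq cuspOrbitOf_numDen_div_prime_eq cuspOrbitOf_numDen_prime_mul_eq)

/-! ### §1 Bounded denominators; the maximum is attained on a path -/

section Structure

variable {p : ℕ} [Fact p.Prime] {N : ℕ} [NeZero N] {I : Type*} [Fintype I] (φ : I → CuspForm (Gamma0 N) 2) (c : I → ℂ)

/-- **Bounded denominators**: every `Ψ` path value has norm `≤ C := max_q ‖ι⁻¹ u_q‖` (whatever the `cᵢ`).
[cite: MazurTateTeitelbaum1986Invent, §I.8] -/
theorem norm_psi_le_sup (ι : PadicAlgCl p ≃+* ℂ) (k : SL(2, ℤ)) :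
    ‖ι.symm (∑ i, c i * (((inftySymbol (φ i) k).re : ℝ) : ℂ))‖ ≤
      Finset.univ.sup' ⟨((1 : SL(2, ℤ)) : Gamma0Coset N), Finset.mem_univ _⟩
        (fun q : Gamma0Coset N ↦ ‖ι.symm (∑ i, c i * ((((msymbol N q) (φ i)).re : ℝ) : ℂ))‖) := by
  set u : Gamma0Coset N → ℂ := fun q ↦ ∑ i, c i * ((((msymbol N q) (φ i)).re : ℝ) : ℂ) with hu
  set C := Finset.univ.sup' ⟨((1 : SL(2, ℤ)) : Gamma0Coset N), Finset.mem_univ _⟩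
    (fun q : Gamma0Coset N ↦ ‖ι.symm (u q)‖) with hC
  have hCq : ∀ q, ‖ι.symm (u q)‖ ≤ C := fun q ↦
    Finset.le_sup' (fun q : Gamma0Coset N ↦ ‖ι.symm (u q)‖) (Finset.mem_univ q)
  have hC0 : 0 ≤ C := (norm_nonneg _).trans (hCq ((1 : SL(2, ℤ)) : Gamma0Coset N))
  obtain ⟨m, hm⟩ := exists_psi_eq_sum φ c k
  rw [hm, map_sum]
  refine IsUltrametricDist.norm_sum_le_of_forall_le_of_nonneg hC0 fun q _ ↦ ?_
  rw [map_mul, map_intCast, norm_mul]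
  exact mul_le_of_le_one_left (norm_nonneg _) (norm_intCast_le_one _) |>.trans (hCq q)

/-- **The maximum is attained at a path**: each `u_q` is a difference of two path values of `Ψ`. [folklore] -/
theorem exists_norm_psi_eq_sup (ι : PadicAlgCl p ≃+* ℂ) :
    ∃ k : SL(2, ℤ), ‖ι.symm (∑ i, c i * (((inftySymbol (φ i) k).re : ℝ) : ℂ))‖ =
      Finset.univ.sup' ⟨((1 : SL(2, ℤ)) : Gamma0Coset N), Finset.mem_univ _⟩
        (fun q : Gamma0Coset N ↦ ‖ι.symm (∑ i, c i * ((((msymbol N q) (φ i)).re : ℝ) : ℂ))‖) := by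
  set Ψk : SL(2, ℤ) → ℂ := fun k ↦ ∑ i, c i * (((inftySymbol (φ i) k).re : ℝ) : ℂ) with hΨk
  set u : Gamma0Coset N → ℂ := fun q ↦ ∑ i, c i * ((((msymbol N q) (φ i)).re : ℝ) : ℂ) with hu
  set C := Finset.univ.sup' ⟨((1 : SL(2, ℤ)) : Gamma0Coset N), Finset.mem_univ _⟩
    (fun q : Gamma0Coset N ↦ ‖ι.symm (u q)‖) with hC
  change ∃ k, ‖ι.symm (Ψk k)‖ = C
  obtain ⟨q₀, -, hq₀⟩ := Finset.exists_mem_eq_sup' ⟨((1 : SL(2, ℤ)) : Gamma0Coset N), Finset.mem_univ _⟩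
    (fun q : Gamma0Coset N ↦ ‖ι.symm (u q)‖)
  set k₀ : SL(2, ℤ) := Quotient.out q₀ with hk₀
  have hmq : ∀ ψ : CuspForm (Gamma0 N) 2, (msymbol N q₀) ψ = inftySymbol ψ k₀⁻¹ - inftySymbol ψ (k₀⁻¹ * S) := by
    intro ψ
    have : q₀ = (k₀ : Gamma0Coset N) := (Quotient.out_eq q₀).symm
    rw [this, msymbol_mk, msymbolFunctional_apply, msymbolSL]
  have huq : u q₀ = Ψk k₀⁻¹ - Ψk (k₀⁻¹ * S) := by
    simp only [hu, hΨk, hmq, Complex.sub_re, Complex.ofReal_sub, mul_sub, Finset.sum_sub_distrib]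
  have hA' := norm_psi_le_sup φ c ι k₀⁻¹
  have hB' := norm_psi_le_sup φ c ι (k₀⁻¹ * S)
  rw [← hC] at hA' hB'
  change ‖ι.symm (Ψk k₀⁻¹)‖ ≤ C at hA'
  change ‖ι.symm (Ψk (k₀⁻¹ * S))‖ ≤ C at hB'
  by_contra hne
  push Not at hne
  have hA'' : ‖ι.symm (Ψk k₀⁻¹)‖ < C := lt_of_le_of_ne hA' (hne _)
  have hB'' : ‖ι.symm (Ψk (k₀⁻¹ * S))‖ < C := lt_of_le_of_ne hB' (hne _)
  have hlt : ‖ι.symm (u q₀)‖ < C := by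
    rw [huq, map_sub, sub_eq_add_neg]
    refine lt_of_le_of_lt (PadicAlgCl.isNonarchimedean p _ _) (max_lt hA'' ?_)
    rwa [norm_neg]
  rw [← hC] at hq₀
  exact absurd hq₀.symm (ne_of_lt hlt)

end Structure

/-! ### §2 The normalisation `Ω`: integral on `ℚ`, a unit on one cycle (ANY level, one prime `r ≡ 1 (mod N)`) -/

section Period

variable {p : ℕ} [Fact p.Prime] {N : ℕ} [NeZero N] {I : Type*} [Fintype I] {φ : I → CuspForm (Gamma0 N) 2} (c : I → ℂ)

/-- ★ **THE CANONICAL-PERIOD NORMALISATION for `Ψ = plusSymbol (Σ cᵢ φᵢ)` at ANY LEVEL** (`φᵢ ∈ S₂(Γ₀(N))` with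
REAL coefficients, `cᵢ ∈ ℂ` arbitrary, `Ψ ≢ 0`, ONE prime `r ≡ 1 (mod N)` — so `r ∤ N` — with
`T_r (Σ cᵢ φᵢ) = a·(Σ cᵢ φᵢ)`, `a` integral and `a − r − 1` a `p`-adic unit): there is `Ω ∈ ℂ` with `Ψ(x)/Ω` integral
for every `x ∈ ℚ` and `Ψ(γ₀∞)/Ω` a UNIT for some `γ₀ ∈ Γ₀(N)`, `γ₀∞ ≠ ∞`. Gen 6's
`…MultiStabPeriod.exists_period_integral_unit_cycle_sum_smul` VERBATIM except for step (E): the reduced symbol is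
constant on `Γ₀(N)`-CUSP CLASSES (§2's first lemma), and the `r + 1` cusps `(x+j)/r`, `rx` of `T_r{∞, x}` lie in the
class of `x` because `r ≡ 1 (mod N)` (§1). [cite: Vatsal1999, §1 (1.3) display (5), (1.5)–(1.6), Remark (1.12)]
[cite: CremonaAlgorithms1997, §2.3 and §2.8] [cite: DiamondShurman2005, §3.8] -/
theorem exists_period_integral_unit_cycle_sum_smul_of_one_mod (ι : PadicAlgCl p ≃+* ℂ)
    (hreal : ∀ i n, (cuspCoeff (φ i) n).im = 0)
    (hne : ∃ x : ℚ, plusSymbol (∑ i, c i • φ i) x ≠ 0)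
    {r : ℕ} (hr : r.Prime) (hrM : ¬ r ∣ N) (hr1 : r ≡ 1 [MOD N]) {a : ℂ} (ha : Valued.v (ι.symm a) ≤ 1)
    (hT : (haveI : NeZero r := ⟨hr.ne_zero⟩; heckeT (Gamma0 N) 2 r (∑ i, c i • φ i)) = a • ∑ i, c i • φ i)
    (hE : Valued.v (ι.symm (a - (r + 1))) = 1) :
    ∃ Ω : ℂ, (∀ x : ℚ, Valued.v (ι.symm (plusSymbol (∑ i, c i • φ i) x / Ω)) ≤ 1) ∧
      ∃ γ₀ : Gamma0 N, (γ₀ : SL(2, ℤ)) 1 0 ≠ 0 ∧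
        Valued.v (ι.symm (plusSymbol (∑ i, c i • φ i)
          ((((γ₀ : SL(2, ℤ)) 0 0 : ℤ) : ℚ) / (((γ₀ : SL(2, ℤ)) 1 0 : ℤ) : ℚ)) / Ω)) = 1 := by
  classical
  haveI := charP_residueField (p := p)
  haveI : NeZero r := ⟨hr.ne_zero⟩
  set res := IsLocalRing.residue (Valued.integer (PadicAlgCl p)) with hres
  set G := ∑ i, c i • φ i with hG
  set Ψk : SL(2, ℤ) → ℂ := fun k ↦ ∑ i, c i * (((inftySymbol (φ i) k).re : ℝ) : ℂ) with hΨk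
  set C := Finset.univ.sup' ⟨((1 : SL(2, ℤ)) : Gamma0Coset N), Finset.mem_univ _⟩
    (fun q : Gamma0Coset N ↦ ‖ι.symm (∑ i, c i * ((((msymbol N q) (φ i)).re : ℝ) : ℂ))‖) with hC
  have hle : ∀ k : SL(2, ℤ), ‖ι.symm (Ψk k)‖ ≤ C := fun k ↦ norm_psi_le_sup φ c ι k
  obtain ⟨kS, hkS⟩ := exists_norm_psi_eq_sup φ c ι
  rw [← hC] at hkS
  change ‖ι.symm (Ψk kS)‖ = C at hkS
  have hΨk_of_ne : ∀ k : SL(2, ℤ), k 1 0 ≠ 0 → Ψk k = plusSymbol G (((k 0 0 : ℤ) : ℚ) / ((k 1 0 : ℤ) : ℚ)) := by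
    intro k hk
    simp only [hΨk, inftySymbol, if_neg hk, hG]
    rw [plusSymbol_sum_smul_eq_re φ c hreal]
  have hΨk_of_eq : ∀ k : SL(2, ℤ), k 1 0 = 0 → Ψk k = 0 := by
    intro k hk
    simp only [hΨk, inftySymbol, if_pos hk, Complex.zero_re, Complex.ofReal_zero, mul_zero, Finset.sum_const_zero]
  have hΨx : ∀ x : ℚ, ∃ k : SL(2, ℤ), k 1 0 ≠ 0 ∧ plusSymbol G x = Ψk k := by
    intro x
    obtain ⟨k, h0, hk1⟩ := exists_sl_apply_eq_num_den x
    refine ⟨k, by rw [hk1]; exact_mod_cast x.den_ne_zero, ?_⟩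
    rw [hG, plusSymbol_sum_smul_eq φ c hreal h0 hk1]
  have hC0 : 0 < C := by
    obtain ⟨x₀, hx₀⟩ := hne
    obtain ⟨k₀, -, hk₀⟩ := hΨx x₀
    have h1' : ι.symm (Ψk k₀) ≠ 0 := by
      rw [map_ne_zero_iff _ ι.symm.injective, ← hk₀]; exact hx₀
    exact (norm_pos_iff.mpr h1').trans_le (hle k₀)
  set Ω : ℂ := Ψk kS with hΩdef
  have hΩC : ‖ι.symm Ω‖ = C := hkS
  have hΩ0 : ι.symm Ω ≠ 0 := by rw [← norm_pos_iff, hΩC]; exact hC0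
  have hkS10 : kS 1 0 ≠ 0 := by
    intro h0
    apply hΩ0
    rw [hΩdef, hΨk_of_eq kS h0, map_zero]
  have hnorm : ∀ z : ℂ, ‖ι.symm (z / Ω)‖ = ‖ι.symm z‖ / C := by
    intro z; rw [map_div₀, norm_div, hΩC]
  have hint : ∀ x : ℚ, Valued.v (ι.symm (plusSymbol G x / Ω)) ≤ 1 := by
    intro x
    obtain ⟨k, -, hk⟩ := hΨx x
    rw [valuation_le_one_iff, hnorm, hk, div_le_one hC0]
    exact hle k
  refine ⟨Ω, hint, ?_⟩
  by_contra H
  push Not at H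
  have hcyc : ∀ γ : Gamma0 N, ‖ι.symm (Ψk γ / Ω)‖ < 1 := by
    intro γ
    by_cases h0 : (γ : SL(2, ℤ)) 1 0 = 0
    · rw [hΨk_of_eq _ h0, zero_div, map_zero, norm_zero]
      exact zero_lt_one
    · have hγ := H γ h0
      rw [hΨk_of_ne _ h0]
      have h1' := hint ((((γ : SL(2, ℤ)) 0 0 : ℤ) : ℚ) / (((γ : SL(2, ℤ)) 1 0 : ℤ) : ℚ))
      rw [valuation_le_one_iff] at h1'
      rw [Ne, valuation_eq_one_iff] at hγ
      exact lt_of_le_of_ne h1' hγ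
  have mX : ∀ x : ℚ, ι.symm (plusSymbol G x / Ω) ∈ Valued.integer (PadicAlgCl p) := fun x ↦
    mem_integer_iff_norm_le_one.mpr (valuation_le_one_iff.mp (hint x))
  let ψ : ℚ → IsLocalRing.ResidueField (Valued.integer (PadicAlgCl p)) := fun x ↦
    res ⟨ι.symm (plusSymbol G x / Ω), mX x⟩
  -- (E) `ψ` is constant on `Γ₀(N)`-cusp classes (ANY level)
  have hE' : ∀ (x y : ℚ) (kx ky : SL(2, ℤ)), kx 0 0 = x.num → kx 1 0 = x.den → ky 0 0 = y.num → ky 1 0 = y.den →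
      cuspOrbitOf N ky = cuspOrbitOf N kx → ψ y = ψ x := by
    intro x y kx ky hx0 hx1 hy0 hy1 horb
    obtain ⟨γ, hγ⟩ := exists_plusSymbol_sum_smul_eq_sub_of_cuspOrbitOf_eq φ c hreal hx0 hx1 hy0 hy1 horb.symm
    have hγ' : plusSymbol G y = plusSymbol G x - Ψk γ := by
      rw [hG, hγ, hΨk]
      simp only [cuspSymbol_eq_inftySymbol]
    have mγ : ι.symm (Ψk γ / Ω) ∈ Valued.integer (PadicAlgCl p) := mem_integer_iff_norm_le_one.mpr (hcyc γ).le
    have hO : (⟨ι.symm (plusSymbol G y / Ω), mX y⟩ : Valued.integer (PadicAlgCl p)) =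
        ⟨ι.symm (plusSymbol G x / Ω), mX x⟩ - ⟨ι.symm (Ψk γ / Ω), mγ⟩ := by
      apply Subtype.ext
      push_cast
      rw [← map_sub, hγ', sub_div]
    show res _ = res _
    rw [hO, map_sub, residue_mk_eq_zero_of_norm_lt_one mγ (hcyc γ), sub_zero]
  -- the Hecke translates at `r ≡ 1 (mod N)` stay in the class of `x`
  have hEdiv : ∀ (x : ℚ) (j : ℤ), ψ ((x + j) / r) = ψ x := by
    intro x j
    obtain ⟨kx, hx0, hx1⟩ := exists_sl_apply_eq_num_den x
    obtain ⟨ky, hy0, hy1⟩ := exists_sl_apply_eq_num_den ((x + j) / r)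
    exact hE' x _ kx ky hx0 hx1 hy0 hy1 (cuspOrbitOf_numDen_div_prime_eq hr hr1 x j hx0 hx1 hy0 hy1)
  have hEmul : ∀ x : ℚ, ψ ((r : ℚ) * x) = ψ x := by
    intro x
    obtain ⟨kx, hx0, hx1⟩ := exists_sl_apply_eq_num_den x
    obtain ⟨ky, hy0, hy1⟩ := exists_sl_apply_eq_num_den ((r : ℚ) * x)
    exact hE' x _ kx ky hx0 hx1 hy0 hy1 (cuspOrbitOf_numDen_prime_mul_eq hr hr1 x hx0 hx1 hy0 hy1)
  -- (F) the Hecke relation of `G` at `r` kills `ψ`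
  have ma : ι.symm a ∈ Valued.integer (PadicAlgCl p) := mem_integer_iff_norm_le_one.mpr (valuation_le_one_iff.mp ha)
  have hunit : res ⟨ι.symm a, ma⟩ - ((r : IsLocalRing.ResidueField (Valued.integer (PadicAlgCl p))) + 1) ≠ 0 := by
    have mE : ι.symm (a - (r + 1)) ∈ Valued.integer (PadicAlgCl p) :=
      mem_integer_iff_norm_le_one.mpr (valuation_eq_one_iff.mp hE).le
    have heq : (⟨ι.symm (a - (r + 1)), mE⟩ : Valued.integer (PadicAlgCl p)) =
        ⟨ι.symm a, ma⟩ - ((r : Valued.integer (PadicAlgCl p)) + 1) := by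
      apply Subtype.ext
      push_cast
      rw [map_sub, map_add, map_natCast, map_one]
    have h : res ⟨ι.symm (a - (r + 1)), mE⟩ =
        res ⟨ι.symm a, ma⟩ - ((r : IsLocalRing.ResidueField (Valued.integer (PadicAlgCl p))) + 1) := by
      rw [heq, map_sub res, map_add res, map_natCast res, map_one res]
    rw [← h, Ne, IsLocalRing.residue_eq_zero_iff, IsLocalRing.mem_maximalIdeal, mem_nonunits_iff, not_not,
      Valuation.Integers.isUnit_iff_valuation_eq_one (Valuation.integer.integers _)]
    exact hE
  have hF : ∀ x : ℚ, ψ x = 0 := by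
    intro x
    have hH := smul_plusSymbol_of_heckeT r hr hrM hT x
    have hO : (⟨ι.symm a, ma⟩ : Valued.integer (PadicAlgCl p)) * ⟨ι.symm (plusSymbol G x / Ω), mX x⟩ =
        (∑ j : Fin r, ⟨ι.symm (plusSymbol G ((x + j) / r) / Ω), mX ((x + j) / r)⟩) +
          ⟨ι.symm (plusSymbol G (r * x) / Ω), mX (r * x)⟩ := by
      apply Subtype.ext
      push_cast
      rw [← map_mul, ← map_sum, ← map_add]
      congr 1
      rw [mul_div_assoc', hG, hH, add_div, Finset.sum_div]
    have h := congrArg res hO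
    rw [map_mul, map_add, map_sum] at h
    have hj : ∀ j : Fin r, res ⟨ι.symm (plusSymbol G ((x + j) / r) / Ω), mX ((x + j) / r)⟩ = ψ x := by
      intro j
      have e : (x + (j : ℚ)) = x + ((j : ℕ) : ℤ) := by push_cast; rfl
      have := hEdiv x ((j : ℕ) : ℤ)
      rw [← e] at this
      exact this
    have hrx : res ⟨ι.symm (plusSymbol G (r * x) / Ω), mX (r * x)⟩ = ψ x := hEmul x
    simp only [hj, hrx, Finset.sum_const, Finset.card_univ, Fintype.card_fin, nsmul_eq_mul] at h
    have hψ : (res ⟨ι.symm a, ma⟩ -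
        ((r : IsLocalRing.ResidueField (Valued.integer (PadicAlgCl p))) + 1)) * ψ x = 0 := by
      rw [sub_mul, add_mul, one_mul, h, sub_self]
    exact (mul_eq_zero.mp hψ).resolve_left hunit
  set xS : ℚ := ((kS 0 0 : ℤ) : ℚ) / ((kS 1 0 : ℤ) : ℚ) with hxS
  have hΩx : plusSymbol G xS = Ω := by rw [hΩdef, hΨk_of_ne kS hkS10]
  have h1' : ψ xS = 1 := by
    have hO : (⟨ι.symm (plusSymbol G xS / Ω), mX xS⟩ : Valued.integer (PadicAlgCl p)) = 1 := by
      apply Subtype.ext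
      push_cast
      rw [hΩx, div_self (fun h ↦ hΩ0 (by rw [h, map_zero])), map_one]
    show res _ = 1
    rw [hO, map_one]
  exact one_ne_zero (h1' ▸ hF xS)

end Period

end Summit.BirchSwinnertonDyer.BirchSwinnertonDyer.Theorems.GL1Cartan.Exc

end
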